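import Literature.Analysis.FluidPDE.NSBoundedMildPicardLimit
import Literature.Analysis.FunctionSpaces.SliceDerivatives
import HarnessLib

/-!
# KNSS 2009, Prop. 4.1: the local smoothing fact `knss2009_local_smoothing` (discharge)

Analysis/FluidPDE proof file (everything proved, no definitions) discharging the named fact
**(L)** `Literature.Analysis.FluidPDE.knss2009_local_smoothing` (`NSBoundedMildSmoothing.lean`;
Koch–Nadirashvili–Seregin–Šverák, Acta Math. 203 (2009) = arXiv:0709.3599, §4 p. 8, Prop. 4.1
with (4.3)–(4.5): for `k, l` given there are `ε, C` such that for bounded data `‖a‖_∞ ≤ M` the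
integral equation `v = e^{ν(t-s)Δ}a - B^ν_s(v,v)` has on `(s, s + εν/M²)` a jointly `C^{k+l}`
solution with `‖v‖ ≤ CM` and `(ν(t-s))^{k/2}(t-s)^l ‖∇ᵏₓ∂ₜˡv‖ ≤ CM`).

The solution is the limit of the weighted Picard iteration
(`exists_oseenMild_of_weighted_estimates`, `NSBoundedMildPicardLimit.lean`, run at order
`N = k + l` with the constants `K` of `WeightedHeatEstimate_holds` and `A` of
`WeightedBilinearEstimate_holds`; `ε = (8AK + 1)⁻²` makes `A √(T/ν) (2KM) ≤ 1/4` for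
`T = εν/M²`, and `C = 2K`). What this file adds is bookkeeping:

* **from isotropic rescaled bounds to the weighted mixed derivatives (4.5)**
  (`weighted_norm_iteratedFDeriv_iteratedDeriv_le`): if the parabolic rescaling
  `W(θ, ξ) = w(tθ, √(νt)ξ)` at scale `t` is `C^{k+l}` near the unit height with
  `‖D^{k+l} W(1, ·)‖ ≤ B`, then `(νt)^{k/2} tˡ ‖∇ᵏₓ∂ₜˡ w(t, x)‖ ≤ B` — the chain rule for the
  dilations `τ ↦ t⁻¹τ` (`iteratedDeriv_comp_mul_left_of_ne_zero`) and `y ↦ (νt)^{-1/2} y`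
  (`norm_iteratedFDeriv_comp_smul_le`), and "nested partials are bounded by the joint derivative"
  (`norm_iteratedFDeriv_slice_iteratedDeriv_le`, `SliceDerivatives.lean`);
* the initial time `s` by the time translation `v(t) = u(t - s)` (`oseenDuhamel_translate`,
  `iteratedDeriv_comp_sub_const`), and data bounded only a.e. through the bounded representative
  `(M / max M ‖a‖) • a` (`heatExtension_congr_ae`: the free term only sees the class of `a`).

Hence `knss2009_local_smoothing_holds`, and with it everything the tree has reduced to (L):
`knss2009_smoothing_of_local`, `mild_L3_smooth_of_local`, `KNSS2009_prop41_mild_of_local`, ….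

## References

* G. Koch, N. Nadirashvili, G. Seregin, V. Šverák, *Liouville theorems for the Navier–Stokes
  equations and applications*, Acta Math. 203 (2009) = arXiv:0709.3599, §1 (1.3), §4 p. 8:
  (4.3)–(4.5), Prop. 4.1, Remark 4.2. [KochNadirashviliSereginSverak2009]
* Y. Giga, K. Inui, S. Matsui, *On the Cauchy problem for the Navier–Stokes equations with
  nondecaying initial data*, Quad. Mat. 4 (1999).
* J. Dieudonné, *Foundations of Modern Analysis* (1960), (8.12) (partial derivatives and the
  chain rule).
-/

noncomputable section

open MeasureTheory Set Function Filter Metric Real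
open _root_.Topology
open scoped ENNReal NNReal ContDiff

namespace Literature.Analysis.FluidPDE

open UnboundedOperators (heatExtension)
open Literature.Analysis.FunctionSpaces

/-! ### Iterated derivatives under dilations (no differentiability hypotheses) -/

section Dilation

variable {E : Type*} [NormedAddCommGroup E] [NormedSpace ℝ E]
  {F : Type*} [NormedAddCommGroup F] [NormedSpace ℝ F]

/-- **One-variable chain rule for a dilation**: `(d/dτ)ˡ [φ(cτ)] (θ) = cˡ • φ⁽ˡ⁾(cθ)` for `c ≠ 0`,
without any differentiability hypothesis (composition with the linear automorphism `τ ↦ cτ` of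
`ℝ`; Mathlib's `iteratedDeriv_comp_const_smul` asks for `ContDiff`). [folklore] -/
theorem iteratedDeriv_comp_mul_left_of_ne_zero (φ : ℝ → F) {c : ℝ} (hc : c ≠ 0) (l : ℕ) (θ : ℝ) :
    iteratedDeriv l (fun τ => φ (c * τ)) θ = c ^ l • iteratedDeriv l φ (c * θ) := by
  set e : ℝ ≃L[ℝ] ℝ := ContinuousLinearEquiv.unitsEquivAut ℝ (Units.mk0 c hc) with he
  have hee : ∀ τ, e τ = c * τ := fun τ => by
    rw [he, ContinuousLinearEquiv.unitsEquivAut_apply, Units.val_mk0, mul_comm]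
  have hcomp : (fun τ => φ (c * τ)) = φ ∘ e := funext fun τ => by rw [comp_apply, hee]
  have h := e.iteratedFDerivWithin_comp_right φ uniqueDiffOn_univ (mem_univ (e θ)) l
  simp only [preimage_univ, iteratedFDerivWithin_univ] at h
  rw [hcomp, iteratedDeriv_eq_iteratedFDeriv, iteratedDeriv_eq_iteratedFDeriv, h,
    ContinuousMultilinearMap.compContinuousLinearMap_apply, hee θ]
  have he1 : (fun i : Fin l => (e : ℝ →L[ℝ] ℝ) ((fun _ : Fin l => (1 : ℝ)) i)) =
      fun i => (fun _ : Fin l => c) i • (fun _ : Fin l => (1 : ℝ)) i := by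
    funext i
    simp only [ContinuousLinearEquiv.coe_coe, hee, smul_eq_mul]
  rw [he1, ContinuousMultilinearMap.map_smul_univ, Finset.prod_const, Finset.card_univ,
    Fintype.card_fin]

/-- **Constants come out of iterated derivatives** over the real field, without any
differentiability hypothesis: `D^k (r • g) = r • D^k g` (`fderiv_const_smul_field`, iterated).
[folklore] -/
theorem iteratedFDeriv_const_smul_real (g : E → F) (r : ℝ) (k : ℕ) :
    iteratedFDeriv ℝ k (fun y => r • g y) = fun y => r • iteratedFDeriv ℝ k g y := by
  induction k with
  | zero =>
    funext y
    ext m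
    simp
  | succ k ih =>
    funext y
    have hf := fderiv_const_smul_field (𝕜 := ℝ) (R := ℝ) (f := iteratedFDeriv ℝ k g) r
    rw [iteratedFDeriv_succ_eq_comp_left, iteratedFDeriv_succ_eq_comp_left, comp_apply, comp_apply,
      ih, ← Pi.smul_def, hf, Pi.smul_apply, LinearIsometryEquiv.map_smul]

/-- **Chain rule for a homothety, in norm**: `‖D^k [ψ(b ·)](x)‖ ≤ |b|^k ‖D^k ψ (bx)‖` for
`b ≠ 0`, without any differentiability hypothesis. [folklore] -/
theorem norm_iteratedFDeriv_comp_smul_le (ψ : E → F) {b : ℝ} (hb : b ≠ 0) (k : ℕ) (x : E) :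
    ‖iteratedFDeriv ℝ k (fun y => ψ (b • y)) x‖ ≤ |b| ^ k * ‖iteratedFDeriv ℝ k ψ (b • x)‖ := by
  set e : E ≃L[ℝ] E := ContinuousLinearEquiv.equivOfInverse (b • ContinuousLinearMap.id ℝ E)
    (b⁻¹ • ContinuousLinearMap.id ℝ E) (fun y => by simp [smul_smul, hb])
    (fun y => by simp [smul_smul, hb]) with he
  have hee : ∀ y, e y = b • y := fun y => rfl
  have hcomp : (fun y => ψ (b • y)) = ψ ∘ e := rfl
  have h := e.iteratedFDerivWithin_comp_right ψ uniqueDiffOn_univ (mem_univ (e x)) k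
  simp only [preimage_univ, iteratedFDerivWithin_univ] at h
  rw [hcomp, h, hee x, mul_comm]
  refine (ContinuousMultilinearMap.norm_compContinuousLinearMap_le _ _).trans ?_
  rw [Finset.prod_const, Finset.card_univ, Fintype.card_fin]
  refine mul_le_mul_of_nonneg_left (pow_le_pow_left₀ (norm_nonneg _) ?_ k) (norm_nonneg _)
  refine ContinuousLinearMap.opNorm_le_bound _ (abs_nonneg b) fun y => ?_
  rw [ContinuousLinearEquiv.coe_coe, hee y, norm_smul, Real.norm_eq_abs]

end Dilation

/-! ### From isotropic rescaled bounds to the weighted mixed derivatives -/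

section Weighted

variable {E : Type*} [NormedAddCommGroup E] [NormedSpace ℝ E]
  {F : Type*} [NormedAddCommGroup F] [NormedSpace ℝ F]

/-- **The weights of (4.5) are the factors picked up under the parabolic rescaling.** Let
`ν, t > 0` and let the rescaling `W = parabolicRescale ν t w`, `W(θ, ξ) = w(tθ, √(νt)ξ)`, be
`C^{k+l}` on `I × E` for an open `I ∋ 1`, with `‖D^{k+l} W (1, ξ)‖ ≤ B` for all `ξ`. Then
`(νt)^{k/2} tˡ ‖∇ᵏₓ∂ₜˡ w (t, x)‖ ≤ B` for all `x`, where
`∇ᵏₓ∂ₜˡ w (t, x) = iteratedFDeriv ℝ k (fun y => iteratedDeriv l (fun τ => w τ y) t) x` (the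
quantity of KNSS 2009, (4.5)): indeed `w(τ, y) = W(τ/t, y/√(νt))`, so
`∇ᵏ∂ˡ w(t, x) = t^{-l} (νt)^{-k/2} ∇ᵏ∂ˡ W(1, x/√(νt)) ∘ (dilations)`, and nested partials are
bounded by the joint derivative. [cite: KochNadirashviliSereginSverak2009, (4.5) and §1 (1.3) (arXiv:0709.3599)] -/
theorem weighted_norm_iteratedFDeriv_iteratedDeriv_le {ν t : ℝ} (hν : 0 < ν) (ht : 0 < t)
    {k l : ℕ} {w : ℝ → E → F} {I : Set ℝ} (hI : IsOpen I) (h1 : (1 : ℝ) ∈ I)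
    (hW : ContDiffOn ℝ (k + l : ℕ) (parabolicRescale ν t w) (I ×ˢ univ)) {B : ℝ}
    (hB : ∀ ξ : E, ‖iteratedFDeriv ℝ (k + l) (parabolicRescale ν t w) (1, ξ)‖ ≤ B) (x : E) :
    (ν * t) ^ ((k : ℝ) / 2) * t ^ l *
        ‖iteratedFDeriv ℝ k (fun y => iteratedDeriv l (fun τ => w τ y) t) x‖ ≤ B := by
  set c : ℝ := Real.sqrt (ν * t) with hc
  have hc0 : 0 < c := Real.sqrt_pos.2 (mul_pos hν ht)
  set W : ℝ × E → F := parabolicRescale ν t w with hWdef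
  -- `w` in terms of its rescaling
  have hwW : ∀ τ y, w τ y = W (t⁻¹ * τ, c⁻¹ • y) := fun τ y => by
    rw [hWdef, parabolicRescale_apply, ← hc]
    simp only [smul_smul, mul_inv_cancel₀ hc0.ne', one_smul, ← mul_assoc, mul_inv_cancel₀ ht.ne',
      one_mul]
  -- the time derivatives: `(d/dτ)ˡ w(·, y) (t) = t^{-l} • ψ(y/c)`, `ψ(η) = ∂_θˡ W(1, η)`
  set ψ : E → F := fun η => iteratedDeriv l (fun θ => W (θ, η)) 1 with hψ
  have hinner : ∀ y, iteratedDeriv l (fun τ => w τ y) t = (t⁻¹) ^ l • ψ (c⁻¹ • y) := by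
    intro y
    have hfun : (fun τ => w τ y) = fun τ => (fun θ => W (θ, c⁻¹ • y)) (t⁻¹ * τ) :=
      funext fun τ => hwW τ y
    calc iteratedDeriv l (fun τ => w τ y) t
        = iteratedDeriv l (fun τ => (fun θ => W (θ, c⁻¹ • y)) (t⁻¹ * τ)) t := by rw [hfun]
      _ = (t⁻¹) ^ l • iteratedDeriv l (fun θ => W (θ, c⁻¹ • y)) (t⁻¹ * t) :=
        iteratedDeriv_comp_mul_left_of_ne_zero (fun θ => W (θ, c⁻¹ • y)) (inv_ne_zero ht.ne') l t
      _ = (t⁻¹) ^ l • ψ (c⁻¹ • y) := by rw [inv_mul_cancel₀ ht.ne']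
  have hfun : (fun y => iteratedDeriv l (fun τ => w τ y) t) = fun y => (t⁻¹) ^ l • (fun z => ψ (c⁻¹ • z)) y :=
    funext hinner
  -- the space derivatives
  have hk : ‖iteratedFDeriv ℝ k (fun y => iteratedDeriv l (fun τ => w τ y) t) x‖ ≤
      (t⁻¹) ^ l * ((c⁻¹) ^ k * ‖iteratedFDeriv ℝ k ψ (c⁻¹ • x)‖) := by
    rw [hfun, iteratedFDeriv_const_smul_real, norm_smul, norm_pow, Real.norm_eq_abs,
      abs_of_pos (inv_pos.2 ht)]
    refine mul_le_mul_of_nonneg_left ?_ (pow_nonneg (inv_pos.2 ht).le l)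
    have h := norm_iteratedFDeriv_comp_smul_le ψ (inv_ne_zero hc0.ne') k x
    rwa [abs_of_pos (inv_pos.2 hc0)] at h
  -- nested partials of the rescaling are bounded by its joint derivative
  have hnest : ‖iteratedFDeriv ℝ k ψ (c⁻¹ • x)‖ ≤ B := by
    have hU : IsOpen (I ×ˢ (univ : Set E)) := hI.prod isOpen_univ
    exact (norm_iteratedFDeriv_slice_iteratedDeriv_le hU hW (mk_mem_prod h1 (mem_univ _))).trans
      (hB _)
  have hB0 : 0 ≤ B := (norm_nonneg _).trans hnest
  -- the weights cancel the dilation factors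
  have hck : (ν * t) ^ ((k : ℝ) / 2) = c ^ k := by
    rw [hc, Real.sqrt_eq_rpow, ← Real.rpow_natCast, ← Real.rpow_mul (mul_pos hν ht).le]
    congr 1
    ring
  have hcne : c ≠ 0 := hc0.ne'
  have htne : t ≠ 0 := ht.ne'
  have hcancel : c ^ k * t ^ l * ((t⁻¹) ^ l * ((c⁻¹) ^ k * ‖iteratedFDeriv ℝ k ψ (c⁻¹ • x)‖)) =
      ‖iteratedFDeriv ℝ k ψ (c⁻¹ • x)‖ := by
    rw [inv_pow, inv_pow]
    field_simp
  rw [hck]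
  calc c ^ k * t ^ l * ‖iteratedFDeriv ℝ k (fun y => iteratedDeriv l (fun τ => w τ y) t) x‖
      ≤ c ^ k * t ^ l * ((t⁻¹) ^ l * ((c⁻¹) ^ k * ‖iteratedFDeriv ℝ k ψ (c⁻¹ • x)‖)) :=
        mul_le_mul_of_nonneg_left hk (by positivity)
    _ = ‖iteratedFDeriv ℝ k ψ (c⁻¹ • x)‖ := hcancel
    _ ≤ B := hnest

end Weighted

/-! ### The discharge -/

section Discharge

variable (E : Type*) [NormedAddCommGroup E] [InnerProductSpace ℝ E] [FiniteDimensional ℝ E]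
  [MeasurableSpace E] [BorelSpace E]

/-- **(L) holds: KNSS 2009, Proposition 4.1 in its quantitative short-time form**
(`knss2009_local_smoothing`). For `k, l` given, run the weighted Picard iteration at order
`N = k + l` (`exists_oseenMild_of_weighted_estimates` with the constants `K` of
`WeightedHeatEstimate_holds` and `A` of `WeightedBilinearEstimate_holds`): with
`ε = (8AK + 1)⁻²` the slab `(0, εν/M²)` is short enough (`A √(T/ν) (2KM) ≤ 1/4`), and the limit
`u` is jointly `C^{k+l}`, solves `u = e^{νtΔ}ã - B^ν_0(u, u)` pointwise for the bounded
representative `ã` of the datum (`e^{νtΔ}ã = e^{νtΔ}a`), and has the scale-invariant bounds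
`2KM` of orders `≤ k + l`, i.e. the weighted bounds (4.5)
(`weighted_norm_iteratedFDeriv_iteratedDeriv_le`); the initial time `s` is restored by the time
translation `v(t) = u(t - s)` (`oseenDuhamel_translate`). Constants: `ε = (8AK+1)⁻²`, `C = 2K`.
[cite: KochNadirashviliSereginSverak2009, Prop. 4.1 with (4.3)–(4.5) (arXiv:0709.3599 p. 8)] -/
theorem knss2009_local_smoothing_holds : knss2009_local_smoothing E := by
  intro k l
  obtain ⟨K, hK0, hH⟩ := WeightedHeatEstimate_holds E (k + l)
  obtain ⟨A, hA0, hB⟩ := WeightedBilinearEstimate_holds (E := E) (k + l)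
  have hD : 0 < 8 * A * K + 1 := by positivity
  refine ⟨1 / (8 * A * K + 1) ^ 2, by positivity, 2 * K, by positivity, ?_⟩
  intro ν hν s M hM a ham haM
  set T : ℝ := 1 / (8 * A * K + 1) ^ 2 * ν / M ^ 2 with hT
  have hTpos : 0 < T := by positivity
  -- the bounded representative of the datum
  set ab : E → E := fun z => (M / max M ‖a z‖) • a z with hab
  have habm : AEStronglyMeasurable ab volume :=
    (continuous_radialRetract hM).comp_aestronglyMeasurable ham
  have habM : ∀ z, ‖ab z‖ ≤ M := fun z => norm_radialRetract_le hM _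
  have haba : ab =ᵐ[volume] a := by
    filter_upwards [ae_norm_le_of_eLpNorm_top_le hM.le haM] with z hz
    exact radialRetract_eq_self hM hz
  -- the smallness of the slab
  have hsqrt : Real.sqrt (T / ν) = 1 / ((8 * A * K + 1) * M) := by
    have h1 : T / ν = (1 / ((8 * A * K + 1) * M)) ^ 2 := by
      rw [hT]; field_simp
    rw [h1, Real.sqrt_sq (by positivity)]
  have hsmall : A * Real.sqrt (T / ν) * (2 * K * M) ≤ 1 / 4 := by
    rw [hsqrt]
    have h1 : A * (1 / ((8 * A * K + 1) * M)) * (2 * K * M) = 2 * A * K / (8 * A * K + 1) := by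
      field_simp
    rw [h1, div_le_iff₀ hD]
    nlinarith [mul_nonneg hA0 hK0]
  obtain ⟨u, hus, hub, huM, hueq, -⟩ := exists_oseenMild_of_weighted_estimates hH hB hν hTpos hM.le
    habm habM le_rfl hsmall
  -- the solution from the initial time `s`
  have hmem : ∀ {t : ℝ}, t ∈ Ioo s (s + T) → t - s ∈ Ioo 0 T := fun ht =>
    ⟨by linarith [ht.1], by linarith [ht.2]⟩
  refine ⟨fun t x => u (t - s) x, ?_, fun t ht x => ?_, fun t ht x => huM (t - s) (hmem ht) x,
    fun t ht x => ?_⟩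
  · -- joint smoothness, by composition with the translation
    have htr : ContDiff ℝ (k + l : ℕ) fun p : ℝ × E => (p.1 - s, p.2) :=
      (contDiff_fst.sub contDiff_const).prodMk contDiff_snd
    have hmaps : MapsTo (fun p : ℝ × E => (p.1 - s, p.2)) (Ioo s (s + T) ×ˢ univ) (Ioo 0 T ×ˢ univ) := by
      intro p hp
      obtain ⟨hp1, -⟩ := mem_prod.1 hp
      exact mk_mem_prod (hmem hp1) (mem_univ _)
    exact hus.comp htr.contDiffOn hmaps
  · -- the equation, by the time translation of the Duhamel term
    have h := hueq (t - s) (hmem ht) x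
    have hD : oseenDuhamel ν 0 u u (t - s) x = oseenDuhamel ν s (fun τ y => u (τ - s) y) (fun τ y => u (τ - s) y) t x := by
      have h2 := oseenDuhamel_translate ν 0 s (fun τ y => u (τ - s) y) (fun τ y => u (τ - s) y) (t - s) x
      simp only [add_sub_cancel_right, zero_add, sub_add_cancel] at h2
      exact h2
    rw [heatExtension_congr_ae haba, hD] at h
    exact h
  · -- the weighted bounds (4.5)
    have ht' : t - s ∈ Ioo 0 T := hmem ht
    have hfun : (fun y => iteratedDeriv l (fun τ => u (τ - s) y) t) =
        fun y => iteratedDeriv l (fun τ => u τ y) (t - s) := by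
      funext y
      exact congrFun (iteratedDeriv_comp_sub_const l (fun τ => u τ y) s) t
    rw [hfun]
    have hI : IsOpen (Ioo 0 (T / (t - s))) := isOpen_Ioo
    have h1 : (1 : ℝ) ∈ Ioo 0 (T / (t - s)) := ⟨one_pos, (one_lt_div ht'.1).2 ht'.2⟩
    have hW : ContDiffOn ℝ (k + l : ℕ) (parabolicRescale ν (t - s) u) (Ioo 0 (T / (t - s)) ×ˢ univ) :=
      contDiffOn_parabolicRescale_of_uncurry hus ν ht'.1
    exact weighted_norm_iteratedFDeriv_iteratedDeriv_le hν ht'.1 hI h1 hW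
      (fun ξ => hub (t - s) ht' (k + l) le_rfl ξ) x

end Discharge

end Literature.Analysis.FluidPDE

end
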